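import Summits.Ventures.HodgeRepro2.T5SU11JacobiPhaseOrbitCovarianceAsymptotic
import Summits.Ventures.HodgeRepro2.T5SU11JacobiMeanPhaseRate
import Summits.Ventures.HodgeRepro2.T5SU11JacobiOrbitMomentRate

/-!
# The rate of the rescaled covariance and of the correlation coefficient of the phase and the orbit radius:
`|Cov_{k,λ}(k log|a|, k|g·0|²/2) − 1| ≤ 81/k`, `|ρ_{k,λ} − 1| ≤ 498/k`

`T5SU11JacobiPhaseOrbitCovarianceAsymptotic` proves `Cov_{k,λ}(k log|a|, k|g·0|²/2) = (k²/2) Cov_{k,λ}(log|a|, |g·0|²) → 1`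
and `ρ_{k,λ} → 1` by the mean value theorem in the weight: `⟨log|a|⟩_{k,λ} − ⟨log|a|⟩_{k+2,λ} = 2 Var_{ξ,λ}(log|a|)` for
some `ξ ∈ (k, k + 2)` (`exists_mean_phase_sub_eq`). The SAME route gives the rate at once, because the rate of the
variance of the phase is already first-order sharp: `|ξ² Var_{ξ,λ}(log|a|) − 1| ≤ 75/ξ` (`T5SU11JacobiMeanPhaseRate`)
and `(k/ξ)² ∈ [(k/(k + 2))², 1]`, `1 − (k/(k + 2))² ≤ 4/k`. Hence, uniformly in `0 ≤ λ ≤ 2` and for `k ≥ 4`: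

* **`|k² (⟨log|a|⟩_{k,λ} − ⟨log|a|⟩_{k+2,λ}) − 2| ≤ 158/k`** (`abs_sq_mul_mean_phase_sub_sub_two_le`) — the
  rate of `tendsto_sq_mul_mean_phase_sub`, WITHOUT the second-order envelopes of the mean phase;
* **`|(k²/2) Cov_{k,λ}(log|a|, |g·0|²) − 1| ≤ 81/k`** (`abs_sq_div_two_mul_covariance_sub_one_le`), from
  `r_k(λ) = 1 − 2/k − λ(λ − 2)/k² ∈ [1 − 2/k, 1]` — the rate of `tendsto_sq_div_two_mul_covariance`;
* **`|ρ_{k,λ} − 1| ≤ 498/k` for `k ≥ 150`** (`abs_correlation_phase_orbit_sq_sub_one_le`), where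
  `ρ_{k,λ} = Cov_{k,λ}(log|a|, |g·0|²)/√(Var_{k,λ}(log|a|) Var_{k,λ}(|g·0|²))` — from the three rates `81/k`,
  `75/k` (`T5SU11JacobiMeanPhaseRate.abs_sq_mul_variance_phase_sub_one_le`) and `18/k`
  (`T5SU11JacobiOrbitMomentRate.abs_sq_div_four_mul_variance_orbit_sq_sub_one_le`) through the elementary
  `|A/√(BC) − 1| ≤ 2(|A − 1| + 2|B − 1| + |C − 1|)` for `B, C ≥ 1/2`, `C ≤ 2` (`abs_div_sqrt_mul_sub_one_le`);
  the threshold `k ≥ 150` only guarantees `k² Var_{k,λ}(log|a|) ≥ 1/2` from the `75/k` rate.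

The constants are explicit, not optimised. Nothing is claimed about (N).

Blind lane: Mathlib + the HodgeRepro2 prefix only; no sorry; axioms ⊆ {propext, Classical.choice,
Quot.sound}.
-/

namespace Summit.Ventures.HodgeRepro2.T5SU11JacobiCovarianceRate

open MeasureTheory MeasureTheory.Measure Metric Set Filter Topology
open T5SU11Unimodular T5SU11Fibration T5SU11Cartan T5SU11CartanProjection T5HaarCircle
  T5BergmanCoefficient T5SU11FibrationHaar T5SU11SphericalFunction T5SU11SphericalSymmetry
  T5SU11SphericalBounds T5SU11SphericalContinuous T5SU11JacobiIwasawa T5SU11JacobiTransform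
  T5SU11JacobiWeight T5SU11KFiniteMajorantPow T5SU11JacobiWeightRecursion T5SU11JacobiPhaseMGF
  T5SU11JacobiMeanPhaseRate T5SU11JacobiOrbitMomentRate T5SU11JacobiPhaseOrbitCovariance
  T5SU11JacobiPhaseOrbitCovarianceAsymptotic
open scoped Real

/-! ### Elementary real inequalities -/

/-- `1 − (k/(k + 2))² ≤ 4/k` for `k > 0`. -/
theorem one_sub_div_add_two_sq_le (k : ℝ) (hk : 0 < k) : 1 - (k / (k + 2)) ^ 2 ≤ 4 / k := by
  have hk2 : 0 < k + 2 := by linarith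
  have e : 1 - (k / (k + 2)) ^ 2 = (4 * k + 4) / (k + 2) ^ 2 := by
    field_simp
    ring
  rw [e, div_le_div_iff₀ (by positivity) hk]
  nlinarith [sq_nonneg k]

/-- `|√x − 1| ≤ |x − 1|` for `x ≥ 0`. -/
theorem abs_sqrt_sub_one_le {x : ℝ} (hx : 0 ≤ x) : |Real.sqrt x - 1| ≤ |x - 1| := by
  have hs := Real.sqrt_nonneg x
  have he : (Real.sqrt x - 1) * (Real.sqrt x + 1) = x - 1 := by
    have := Real.sq_sqrt hx
    nlinarith
  calc |Real.sqrt x - 1| = |Real.sqrt x - 1| * 1 := (mul_one _).symm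
    _ ≤ |Real.sqrt x - 1| * (Real.sqrt x + 1) :=
        mul_le_mul_of_nonneg_left (by linarith) (abs_nonneg _)
    _ = |(Real.sqrt x - 1) * (Real.sqrt x + 1)| := by
        rw [abs_mul, abs_of_pos (by linarith : 0 < Real.sqrt x + 1)]
    _ = |x - 1| := by rw [he]

/-- **The elementary rate of a normalised quotient**: if `|A − 1| ≤ α`, `|B − 1| ≤ β`, `|C − 1| ≤ γ` with
`1/2 ≤ B`, `1/2 ≤ C` and `C ≤ 2`, then `|A/√(BC) − 1| ≤ 2(α + 2β + γ)`. -/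
theorem abs_div_sqrt_mul_sub_one_le {A B C α β γ : ℝ} (hA : |A - 1| ≤ α) (hB : |B - 1| ≤ β)
    (hC : |C - 1| ≤ γ) (hB' : 1 / 2 ≤ B) (hC' : 1 / 2 ≤ C) (hC2 : C ≤ 2) :
    |A / Real.sqrt (B * C) - 1| ≤ 2 * (α + 2 * β + γ) := by
  have hBC : 1 / 4 ≤ B * C := by nlinarith
  have hBC0 : 0 ≤ B * C := by linarith
  have hs : 1 / 2 ≤ Real.sqrt (B * C) := by
    rw [Real.le_sqrt (by norm_num) hBC0]
    linarith
  have hs0 : 0 < Real.sqrt (B * C) := by linarith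
  -- `|BC − 1| ≤ |B − 1| C + |C − 1| ≤ 2β + γ`
  have h1 : |B * C - 1| ≤ 2 * β + γ := by
    have e : B * C - 1 = (B - 1) * C + (C - 1) := by ring
    rw [e]
    calc |(B - 1) * C + (C - 1)| ≤ |(B - 1) * C| + |C - 1| := abs_add_le _ _
      _ = |B - 1| * C + |C - 1| := by rw [abs_mul, abs_of_nonneg (by linarith : 0 ≤ C)]
      _ ≤ β * 2 + γ := add_le_add (mul_le_mul hB hC2 (by linarith) (by linarith [abs_nonneg (B - 1)])) hC
      _ = 2 * β + γ := by ring
  have h2 : |Real.sqrt (B * C) - 1| ≤ 2 * β + γ := (abs_sqrt_sub_one_le hBC0).trans h1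
  -- `|A/√(BC) − 1| = |A − √(BC)|/√(BC) ≤ 2 (|A − 1| + |√(BC) − 1|)`
  have e : A / Real.sqrt (B * C) - 1 = (A - Real.sqrt (B * C)) / Real.sqrt (B * C) := by
    field_simp
  rw [e, abs_div, abs_of_pos hs0, div_le_iff₀ hs0]
  have h3 : |A - Real.sqrt (B * C)| ≤ α + (2 * β + γ) := by
    calc |A - Real.sqrt (B * C)| = |(A - 1) - (Real.sqrt (B * C) - 1)| := by ring_nf
      _ ≤ |A - 1| + |Real.sqrt (B * C) - 1| := abs_sub _ _
      _ ≤ α + (2 * β + γ) := add_le_add hA h2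
  have hα : 0 ≤ α + (2 * β + γ) := le_trans (abs_nonneg _) h3
  nlinarith

section measure

variable [MeasurableSpace Circle] [BorelSpace Circle]

/-! ### The rate of the difference of mean phases -/

/-- **THE RATE OF `k² (⟨log|a|⟩_{k,λ} − ⟨log|a|⟩_{k+2,λ}) → 2`**: for `k ≥ 4`, `0 ≤ λ ≤ 2`,
`|k² (⟨log|a|⟩_{k,λ} − ⟨log|a|⟩_{k+2,λ}) − 2| ≤ 158/k` — by the mean value theorem in the weight and the rate
`|ξ² Var_{ξ,λ}(log|a|) − 1| ≤ 75/ξ` of `T5SU11JacobiMeanPhaseRate`. -/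
theorem abs_sq_mul_mean_phase_sub_sub_two_le {k lam : ℝ} (hk : 4 ≤ k) (h0 : 0 ≤ lam) (h2 : lam ≤ 2) :
    |k ^ 2 * ((∫ g, Real.log ‖mat g 0 0‖ * ((1 - ‖orbit g‖ ^ 2) ^ (k / 2) * sph lam g) ∂(nu haarCircle))
          / (∫ g, (1 - ‖orbit g‖ ^ 2) ^ (k / 2) * sph lam g ∂(nu haarCircle))
        - (∫ g, Real.log ‖mat g 0 0‖ * ((1 - ‖orbit g‖ ^ 2) ^ ((k + 2) / 2) * sph lam g) ∂(nu haarCircle))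
          / (∫ g, (1 - ‖orbit g‖ ^ 2) ^ ((k + 2) / 2) * sph lam g ∂(nu haarCircle))) - 2| ≤ 158 / k := by
  have hk0 : 0 < k := by linarith
  obtain ⟨ξ, hξ, he⟩ := exists_mean_phase_sub_eq (k := k) (lam := lam) (by linarith) (by linarith) (by linarith)
  rw [he]
  have hξ0 : 0 < ξ := by linarith [hξ.1]
  have hξ4 : 4 ≤ ξ := by linarith [hξ.1]
  set V : ℝ := (∫ g, Real.log ‖mat g 0 0‖ ^ 2 * ((1 - ‖orbit g‖ ^ 2) ^ (ξ / 2) * sph lam g) ∂(nu haarCircle))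
        / (∫ g, (1 - ‖orbit g‖ ^ 2) ^ (ξ / 2) * sph lam g ∂(nu haarCircle))
      - ((∫ g, Real.log ‖mat g 0 0‖ * ((1 - ‖orbit g‖ ^ 2) ^ (ξ / 2) * sph lam g) ∂(nu haarCircle))
        / (∫ g, (1 - ‖orbit g‖ ^ 2) ^ (ξ / 2) * sph lam g ∂(nu haarCircle))) ^ 2 with hV
  have hrate := abs_sq_mul_variance_phase_sub_one_le hξ4 h0 h2
  rw [← hV] at hrate
  -- `x := ξ² V`, `|x − 1| ≤ 75/ξ ≤ 75/k`; `q := (k/ξ)² ∈ [(k/(k+2))², 1]`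
  set x : ℝ := ξ ^ 2 * V with hx
  set q : ℝ := (k / ξ) ^ 2 with hq
  have hx1 : |x - 1| ≤ 75 / k := by
    refine hrate.trans ?_
    exact div_le_div_of_nonneg_left (by norm_num) hk0 hξ.1.le
  have hq1 : q ≤ 1 := by
    rw [hq, div_pow, div_le_one (by positivity)]
    exact pow_le_pow_left₀ hk0.le hξ.1.le 2
  have hq0 : 0 ≤ q := by rw [hq]; positivity
  have hq2 : 1 - q ≤ 4 / k := by
    refine le_trans ?_ (one_sub_div_add_two_sq_le k hk0)
    have : (k / (k + 2)) ^ 2 ≤ q := by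
      rw [hq]
      exact pow_le_pow_left₀ (by positivity) (div_le_div_of_nonneg_left hk0.le hξ0 hξ.2.le) 2
    linarith
  have e : k ^ 2 * (2 * V) - 2 = 2 * q * (x - 1) + 2 * (q - 1) := by
    rw [hx, hq, div_pow]
    field_simp
    ring
  rw [e]
  have ha1 : |2 * q * (x - 1)| = 2 * q * |x - 1| := by
    rw [abs_mul, abs_of_nonneg (mul_nonneg (by norm_num) hq0)]
  have ha2 : |2 * (q - 1)| = 2 * (1 - q) := by
    rw [abs_mul, abs_of_nonneg (by norm_num : (0 : ℝ) ≤ 2), abs_of_nonpos (by linarith : q - 1 ≤ 0)]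
    ring
  calc |2 * q * (x - 1) + 2 * (q - 1)| ≤ |2 * q * (x - 1)| + |2 * (q - 1)| := abs_add_le _ _
    _ = 2 * q * |x - 1| + 2 * (1 - q) := by rw [ha1, ha2]
    _ ≤ 2 * 1 * (75 / k) + 2 * (4 / k) := by
        gcongr
    _ = 158 / k := by ring

/-! ### The rate of the rescaled covariance -/

/-- **THE RATE OF THE RESCALED COVARIANCE**: for `k ≥ 4`, `0 ≤ λ ≤ 2`,
`|Cov_{k,λ}(k log|a|, k|g·0|²/2) − 1| = |(k²/2) Cov_{k,λ}(log|a|, |g·0|²) − 1| ≤ 81/k` — the rate of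
`T5SU11JacobiPhaseOrbitCovarianceAsymptotic.tendsto_sq_div_two_mul_covariance`. -/
theorem abs_sq_div_two_mul_covariance_sub_one_le {k lam : ℝ} (hk : 4 ≤ k) (h0 : 0 ≤ lam) (h2 : lam ≤ 2) :
    |k ^ 2 / 2 *
      ((∫ g, Real.log ‖mat g 0 0‖ * ‖orbit g‖ ^ 2 * ((1 - ‖orbit g‖ ^ 2) ^ (k / 2) * sph lam g)
            ∂(nu haarCircle))
          / (∫ g, (1 - ‖orbit g‖ ^ 2) ^ (k / 2) * sph lam g ∂(nu haarCircle))
        - ((∫ g, Real.log ‖mat g 0 0‖ * ((1 - ‖orbit g‖ ^ 2) ^ (k / 2) * sph lam g) ∂(nu haarCircle))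
            / (∫ g, (1 - ‖orbit g‖ ^ 2) ^ (k / 2) * sph lam g ∂(nu haarCircle)))
          * ((∫ g, ‖orbit g‖ ^ 2 * ((1 - ‖orbit g‖ ^ 2) ^ (k / 2) * sph lam g) ∂(nu haarCircle))
            / (∫ g, (1 - ‖orbit g‖ ^ 2) ^ (k / 2) * sph lam g ∂(nu haarCircle)))) - 1| ≤ 81 / k := by
  have hk0 : 0 < k := by linarith
  rw [covariance_phase_orbit_sq_eq (by linarith) (by linarith) (by linarith)]
  have hD := abs_sq_mul_mean_phase_sub_sub_two_le hk h0 h2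
  set D : ℝ := (∫ g, Real.log ‖mat g 0 0‖ * ((1 - ‖orbit g‖ ^ 2) ^ (k / 2) * sph lam g) ∂(nu haarCircle))
          / (∫ g, (1 - ‖orbit g‖ ^ 2) ^ (k / 2) * sph lam g ∂(nu haarCircle))
        - (∫ g, Real.log ‖mat g 0 0‖ * ((1 - ‖orbit g‖ ^ 2) ^ ((k + 2) / 2) * sph lam g) ∂(nu haarCircle))
          / (∫ g, (1 - ‖orbit g‖ ^ 2) ^ ((k + 2) / 2) * sph lam g ∂(nu haarCircle)) with hDdef
  -- `r_k(λ) ∈ [1 − 2/k, 1]` on `0 ≤ λ ≤ 2`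
  have hr := weightRatio_eq hk0.ne' lam
  have hμ0 : lam * (lam - 2) ≤ 0 := by nlinarith
  have hμ1 : -1 ≤ lam * (lam - 2) := by nlinarith [sq_nonneg (lam - 1)]
  have hμ2 : lam * (lam - 2) / k ^ 2 ≤ 0 := by
    rw [div_le_iff₀ (by positivity)]
    linarith
  have hμ3 : -(1 / k ^ 2) ≤ lam * (lam - 2) / k ^ 2 := by
    rw [← neg_div]
    exact div_le_div_of_nonneg_right hμ1 (by positivity)
  have hkk : 1 / k ^ 2 ≤ 2 / k := by
    rw [div_le_div_iff₀ (by positivity) hk0]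
    nlinarith
  have hr1 : weightRatio k lam ≤ 1 := by
    rw [hr]
    linarith
  have hr0 : 1 - 2 / k ≤ weightRatio k lam := by
    rw [hr]
    linarith
  have hr2 : |weightRatio k lam - 1| ≤ 2 / k := by
    rw [abs_le]
    constructor <;> linarith
  have hrpos : 0 ≤ weightRatio k lam := by
    have : 2 / k ≤ 1 / 2 := by
      rw [div_le_div_iff₀ hk0 (by norm_num)]
      linarith
    linarith
  -- `(k²/2) r D − 1 = (r − 1) + r (k² D − 2)/2`
  have e : k ^ 2 / 2 * (weightRatio k lam * D) - 1
      = (weightRatio k lam - 1) + weightRatio k lam * ((k ^ 2 * D - 2) / 2) := by ring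
  rw [e]
  calc |(weightRatio k lam - 1) + weightRatio k lam * ((k ^ 2 * D - 2) / 2)|
      ≤ |weightRatio k lam - 1| + |weightRatio k lam * ((k ^ 2 * D - 2) / 2)| := abs_add_le _ _
    _ = |weightRatio k lam - 1| + weightRatio k lam * (|k ^ 2 * D - 2| / 2) := by
        rw [abs_mul, abs_of_nonneg hrpos, abs_div, abs_of_pos (by norm_num : (0 : ℝ) < 2)]
    _ ≤ 2 / k + 1 * ((158 / k) / 2) := by gcongr
    _ = 81 / k := by ring

/-! ### The rate of the correlation coefficient -/

/-- **THE RATE OF THE CORRELATION COEFFICIENT**: for `k ≥ 150`, `0 ≤ λ ≤ 2`,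
`|ρ_{k,λ} − 1| ≤ 498/k`, `ρ_{k,λ} = Cov_{k,λ}(log|a|, |g·0|²)/√(Var_{k,λ}(log|a|) Var_{k,λ}(|g·0|²))` — the rate
of `T5SU11JacobiPhaseOrbitCovarianceAsymptotic.tendsto_correlation_phase_orbit_sq` (the threshold `150` makes
`k² Var_{k,λ}(log|a|) ≥ 1/2` from the rate `75/k`). -/
theorem abs_correlation_phase_orbit_sq_sub_one_le {k lam : ℝ} (hk : 150 ≤ k) (h0 : 0 ≤ lam) (h2 : lam ≤ 2) :
    |((∫ g, Real.log ‖mat g 0 0‖ * ‖orbit g‖ ^ 2 * ((1 - ‖orbit g‖ ^ 2) ^ (k / 2) * sph lam g)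
            ∂(nu haarCircle))
          / (∫ g, (1 - ‖orbit g‖ ^ 2) ^ (k / 2) * sph lam g ∂(nu haarCircle))
        - ((∫ g, Real.log ‖mat g 0 0‖ * ((1 - ‖orbit g‖ ^ 2) ^ (k / 2) * sph lam g) ∂(nu haarCircle))
            / (∫ g, (1 - ‖orbit g‖ ^ 2) ^ (k / 2) * sph lam g ∂(nu haarCircle)))
          * ((∫ g, ‖orbit g‖ ^ 2 * ((1 - ‖orbit g‖ ^ 2) ^ (k / 2) * sph lam g) ∂(nu haarCircle))
            / (∫ g, (1 - ‖orbit g‖ ^ 2) ^ (k / 2) * sph lam g ∂(nu haarCircle))))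
      / Real.sqrt
        (((∫ g, Real.log ‖mat g 0 0‖ ^ 2 * ((1 - ‖orbit g‖ ^ 2) ^ (k / 2) * sph lam g) ∂(nu haarCircle))
            / (∫ g, (1 - ‖orbit g‖ ^ 2) ^ (k / 2) * sph lam g ∂(nu haarCircle))
          - ((∫ g, Real.log ‖mat g 0 0‖ * ((1 - ‖orbit g‖ ^ 2) ^ (k / 2) * sph lam g) ∂(nu haarCircle))
            / (∫ g, (1 - ‖orbit g‖ ^ 2) ^ (k / 2) * sph lam g ∂(nu haarCircle))) ^ 2)
        * ((∫ g, (‖orbit g‖ ^ 2) ^ 2 * ((1 - ‖orbit g‖ ^ 2) ^ (k / 2) * sph lam g) ∂(nu haarCircle))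
            / (∫ g, (1 - ‖orbit g‖ ^ 2) ^ (k / 2) * sph lam g ∂(nu haarCircle))
          - ((∫ g, ‖orbit g‖ ^ 2 * ((1 - ‖orbit g‖ ^ 2) ^ (k / 2) * sph lam g) ∂(nu haarCircle))
            / (∫ g, (1 - ‖orbit g‖ ^ 2) ^ (k / 2) * sph lam g ∂(nu haarCircle))) ^ 2)) - 1| ≤ 498 / k := by
  have hk0 : 0 < k := by linarith
  have hk4 : 4 ≤ k := by linarith
  have hA := abs_sq_div_two_mul_covariance_sub_one_le hk4 h0 h2
  have hB := abs_sq_mul_variance_phase_sub_one_le hk4 h0 h2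
  have hC := abs_sq_div_four_mul_variance_orbit_sq_sub_one_le hk4 h0 h2
  set Cov : ℝ := (∫ g, Real.log ‖mat g 0 0‖ * ‖orbit g‖ ^ 2 * ((1 - ‖orbit g‖ ^ 2) ^ (k / 2) * sph lam g)
            ∂(nu haarCircle))
          / (∫ g, (1 - ‖orbit g‖ ^ 2) ^ (k / 2) * sph lam g ∂(nu haarCircle))
        - ((∫ g, Real.log ‖mat g 0 0‖ * ((1 - ‖orbit g‖ ^ 2) ^ (k / 2) * sph lam g) ∂(nu haarCircle))
            / (∫ g, (1 - ‖orbit g‖ ^ 2) ^ (k / 2) * sph lam g ∂(nu haarCircle)))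
          * ((∫ g, ‖orbit g‖ ^ 2 * ((1 - ‖orbit g‖ ^ 2) ^ (k / 2) * sph lam g) ∂(nu haarCircle))
            / (∫ g, (1 - ‖orbit g‖ ^ 2) ^ (k / 2) * sph lam g ∂(nu haarCircle))) with hCov
  set V₁ : ℝ := (∫ g, Real.log ‖mat g 0 0‖ ^ 2 * ((1 - ‖orbit g‖ ^ 2) ^ (k / 2) * sph lam g) ∂(nu haarCircle))
            / (∫ g, (1 - ‖orbit g‖ ^ 2) ^ (k / 2) * sph lam g ∂(nu haarCircle))
          - ((∫ g, Real.log ‖mat g 0 0‖ * ((1 - ‖orbit g‖ ^ 2) ^ (k / 2) * sph lam g) ∂(nu haarCircle))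
            / (∫ g, (1 - ‖orbit g‖ ^ 2) ^ (k / 2) * sph lam g ∂(nu haarCircle))) ^ 2 with hV₁
  set V₂ : ℝ := (∫ g, (‖orbit g‖ ^ 2) ^ 2 * ((1 - ‖orbit g‖ ^ 2) ^ (k / 2) * sph lam g) ∂(nu haarCircle))
            / (∫ g, (1 - ‖orbit g‖ ^ 2) ^ (k / 2) * sph lam g ∂(nu haarCircle))
          - ((∫ g, ‖orbit g‖ ^ 2 * ((1 - ‖orbit g‖ ^ 2) ^ (k / 2) * sph lam g) ∂(nu haarCircle))
            / (∫ g, (1 - ‖orbit g‖ ^ 2) ^ (k / 2) * sph lam g ∂(nu haarCircle))) ^ 2 with hV₂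
  -- rescale: `Cov/√(V₁ V₂) = A/√(B C)` with `A = (k²/2) Cov`, `B = k² V₁`, `C = (k²/4) V₂`
  have hk2 : 0 < k ^ 2 / 2 := by positivity
  have e : Cov / Real.sqrt (V₁ * V₂) = (k ^ 2 / 2 * Cov) / Real.sqrt ((k ^ 2 * V₁) * (k ^ 2 / 4 * V₂)) := by
    rw [show (k ^ 2 * V₁) * (k ^ 2 / 4 * V₂) = (k ^ 2 / 2) ^ 2 * (V₁ * V₂) by ring,
      Real.sqrt_mul (sq_nonneg _), Real.sqrt_sq hk2.le, mul_div_mul_left _ _ hk2.ne']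
  rw [e]
  -- the three rates and the margins at `k ≥ 150`
  have h75 : 75 / k ≤ 1 / 2 := by
    rw [div_le_div_iff₀ hk0 (by norm_num)]
    linarith
  have h18 : 18 / k ≤ 1 / 2 := by
    rw [div_le_div_iff₀ hk0 (by norm_num)]
    linarith
  have hB' : 1 / 2 ≤ k ^ 2 * V₁ := by
    have := (abs_le.mp hB).1
    linarith
  have hC' : 1 / 2 ≤ k ^ 2 / 4 * V₂ := by
    have := (abs_le.mp hC).1
    linarith
  have hC2 : k ^ 2 / 4 * V₂ ≤ 2 := by
    have := (abs_le.mp hC).2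
    linarith
  refine (abs_div_sqrt_mul_sub_one_le hA hB hC hB' hC' hC2).trans (le_of_eq ?_)
  ring

end measure

end Summit.Ventures.HodgeRepro2.T5SU11JacobiCovarianceRate
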